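import Mathlib
import Summits.SmoothPoincare4.SmoothPoincare4.Theorems.CylinderEntropySliceIsolationCertCheckAtoms
import HarnessLib

/-!
# The certificate checker of the conformal kernel domination, III: soundness of boxes, cells and covers

File III of III on the computable checker `Cert.checkCover` (line `conformal-kernel-domination` of the crux
`Summit.SmoothPoincare4.SmoothPoincare4.Theses.CylinderEntropy.SliceIsolation`, crux item stmt-SmoothPoincare4-7632,
stubs `stub_certMidA/B/C`).  Proved here: the leaf test and the adaptive bisection are sound
(`Cert.leaf_sound`, `Cert.checkBox_sound`); an accepted cell dominates the kernel for every `T` of the cell,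
`u ∈ ℝ`, `s ∈ [-1, 1]` (`Cert.checkCell_sound`, with the `u`-tails `Cert.pulled_le_of_u_le` /
`Cert.pulled_le_of_le_u`); an accepted cell, resp. cover, yields the REGISTERED certificate statement
(`Cert.certificate_of_checkCell`, `Cert.certificates_of_checkCover` = `helper_certCheckCover`).  The data files
of the decade stubs are then certificate literals plus one `native_decide` each (`--computational`).
No definitions, no named facts.
-/

-- the registered namespace `Summit.SmoothPoincare4.SmoothPoincare4.Theorems…` repeats a component
set_option linter.dupNamespace false

namespace Summit.SmoothPoincare4.SmoothPoincare4.Theorems.CylinderEntropySliceIsolation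

open Literature.Geometry.Riemannian.SphericalCylinderEntropy
  Literature.Geometry.Riemannian.SphericalZonalKernelSeries

namespace Cert

variable (C : Cell)

/-! ### Boxes -/

/-- **Leaf soundness.** [folklore] -/
theorem leaf_sound (hT1 : 0 < C.T1) (hat : atomsOK C C.atoms = true)
    {u1 u2 s1 s2 : ℚ} (hs1 : -1 ≤ s1) (hs2 : s2 ≤ 1)
    (hleaf : leafOK C (C.atoms.map (zonalTable C)) u1 u2 s1 s2 = true)
    {T u s : ℝ} (hT : ((C.T1 : ℚ) : ℝ) ≤ T) (hT' : T ≤ ((C.T2 : ℚ) : ℝ)) (hu1 : ((u1 : ℚ) : ℝ) ≤ u)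
    (hu2 : u ≤ ((u2 : ℚ) : ℝ)) (hsl : ((s1 : ℚ) : ℝ) ≤ s) (hsr : s ≤ ((s2 : ℚ) : ℝ)) :
    pulledR T u s ≤ C.rhs u s := by
  simp only [leafOK, decide_eq_true_eq] at hleaf
  have hs0 : -1 ≤ s := le_trans (by exact_mod_cast hs1) hsl
  have hs3 : s ≤ 1 := hsr.trans (by exact_mod_cast hs2)
  have h1 := pulled_le_pulledHi C hT1 hs2 hT hT' hu1 hu2 hs0 hsr
  have h2 := atomsLo_le C C.atoms hat hs1 hu1 hu2 hsl hs3
  unfold Cell.rhs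
  calc pulledR T u s ≤ ((pulledHi C u1 u2 s2 : ℚ) : ℝ) := h1
    _ ≤ ((C.c + atomsLo C C.atoms (C.atoms.map (zonalTable C)) u1 u2 s1 : ℚ) : ℝ) := by
        exact_mod_cast hleaf
    _ ≤ atomsVal C.atoms u s + (C.c : ℝ) := by push_cast; linarith

/-- **Bisection soundness.** [folklore] -/
theorem checkBox_sound (hT1 : 0 < C.T1) (hat : atomsOK C C.atoms = true) :
    ∀ (fuel : ℕ) (u1 u2 s1 s2 : ℚ), -1 ≤ s1 → s2 ≤ 1 →
      checkBox C (C.atoms.map (zonalTable C)) fuel u1 u2 s1 s2 = true →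
      ∀ {T u s : ℝ}, ((C.T1 : ℚ) : ℝ) ≤ T → T ≤ ((C.T2 : ℚ) : ℝ) → ((u1 : ℚ) : ℝ) ≤ u →
        u ≤ ((u2 : ℚ) : ℝ) → ((s1 : ℚ) : ℝ) ≤ s → s ≤ ((s2 : ℚ) : ℝ) → pulledR T u s ≤ C.rhs u s := by
  intro fuel
  induction fuel with
  | zero => intro u1 u2 s1 s2 _ _ h; simp [checkBox] at h
  | succ fuel ih =>
    intro u1 u2 s1 s2 hs1 hs2 h T u s hT hT' hu1 hu2 hsl hsr
    simp only [checkBox, Bool.or_eq_true] at h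
    rcases h with hleaf | hsplit
    · exact leaf_sound C hT1 hat hs1 hs2 hleaf hT hT' hu1 hu2 hsl hsr
    · split_ifs at hsplit with hdir
      · simp only [Bool.and_eq_true] at hsplit
        have hm : (((u1 + u2) / 2 : ℚ) : ℝ) = ((u1 : ℝ) + (u2 : ℝ)) / 2 := by push_cast; ring
        rcases le_or_gt u (((u1 : ℝ) + (u2 : ℝ)) / 2) with hle | hgt
        · exact ih u1 _ s1 s2 hs1 hs2 hsplit.1 hT hT' hu1 (by rw [hm]; exact hle) hsl hsr
        · exact ih _ u2 s1 s2 hs1 hs2 hsplit.2 hT hT' (by rw [hm]; exact hgt.le) hu2 hsl hsr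
      · simp only [Bool.and_eq_true] at hsplit
        have hm : (((s1 + s2) / 2 : ℚ) : ℝ) = ((s1 : ℝ) + (s2 : ℝ)) / 2 := by push_cast; ring
        have hmid1 : (s1 + s2) / 2 ≤ 1 := by
          have : s1 ≤ 1 := by
            have h' : ((s1 : ℚ) : ℝ) ≤ 1 := hsl.trans (hsr.trans (by exact_mod_cast hs2))
            exact_mod_cast h'
          linarith
        have hmid2 : -1 ≤ (s1 + s2) / 2 := by
          have : -1 ≤ s2 := by
            have h' : (-1 : ℝ) ≤ ((s2 : ℚ) : ℝ) := le_trans (le_trans (by exact_mod_cast hs1) hsl) hsr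
            exact_mod_cast h'
          linarith
        rcases le_or_gt s (((s1 : ℝ) + (s2 : ℝ)) / 2) with hle | hgt
        · exact ih u1 u2 s1 _ hs1 hmid1 hsplit.1 hT hT' hu1 hu2 hsl (by rw [hm]; exact hle)
        · exact ih u1 u2 _ s2 hmid2 hs2 hsplit.2 hT hT' hu1 hu2 (by rw [hm]; exact hgt.le) hsr

/-! ### Cells -/

/-- **Cell soundness**: an accepted cell certificate dominates the kernel for every `T` of the cell,
every `u ∈ ℝ` and every `s ∈ [-1, 1]`. [folklore] -/
theorem checkCell_sound {M : ℚ} (h : checkCell C M = true) {T : ℝ} (hT : ((C.T1 : ℚ) : ℝ) ≤ T)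
    (hT' : T ≤ ((C.T2 : ℚ) : ℝ)) (u s : ℝ) (hs1 : -1 ≤ s) (hs2 : s ≤ 1) :
    pulledR T u s ≤ C.rhs u s := by
  simp only [checkCell, Bool.and_eq_true, decide_eq_true_eq] at h
  obtain ⟨⟨⟨⟨⟨⟨⟨hT1, hT12⟩, hc⟩, _⟩, hat⟩, _⟩, htails⟩, hbox⟩ := h
  simp only [tailsOK, Bool.and_eq_true, decide_eq_true_eq] at htails
  obtain ⟨⟨⟨hlow, h1e⟩, hbig⟩, hhigh⟩ := htails
  have hT1r : (0 : ℝ) < (C.T1 : ℝ) := by exact_mod_cast hT1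
  have hrhs : (C.c : ℝ) ≤ C.rhs u s := by
    unfold Cell.rhs
    linarith [atomsVal_nonneg C C.atoms hat (u := u) hs1 hs2]
  rcases lt_or_ge u (C.uMin : ℝ) with hlo | hge
  · -- below `uMin`
    have h := pulled_le_of_u_le (C.T1 : ℝ) (C.T2 : ℝ) T u (C.uMin : ℝ) s hT1r hT hT' hlo.le hs1 hs2
    refine le_trans ?_ hrhs
    refine h.trans ?_
    have h4 := exp_le_expHi (4 * C.uMin) C.prec
    have hlow' : (((expHi (4 * C.uMin) C.prec / (6 * C.T1 ^ 2) : ℚ)) : ℝ) ≤ (C.c : ℝ) := by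
      exact_mod_cast hlow
    push_cast at h4 hlow'
    calc (6 * (C.T1 : ℝ) ^ 2)⁻¹ * Real.exp (4 * (C.uMin : ℝ))
        ≤ (6 * (C.T1 : ℝ) ^ 2)⁻¹ * ((expHi (4 * C.uMin) C.prec : ℚ) : ℝ) :=
          mul_le_mul_of_nonneg_left h4 (by positivity)
      _ = ((expHi (4 * C.uMin) C.prec : ℚ) : ℝ) / (6 * (C.T1 : ℝ) ^ 2) := by ring
      _ ≤ (C.c : ℝ) := hlow'
  rcases le_or_gt u (C.uMax : ℝ) with hle | hgt
  · -- the bisected range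
    unfold pulledR
    exact checkBox_sound C hT1 hat C.depth C.uMin C.uMax (-1) 1 (le_refl _) (le_refl _) hbox hT hT'
      hge hle (by exact_mod_cast hs1) (by exact_mod_cast hs2)
  · -- above `uMax`
    set eU : ℚ := expLo C.uMax C.prec with heU
    have heUr : ((eU : ℚ) : ℝ) ≤ Real.exp (C.uMax : ℝ) := expLo_le _ _
    have h1e' : (1 : ℝ) ≤ ((eU : ℚ) : ℝ) := by exact_mod_cast h1e
    have hbig' : 8 * (C.T2 : ℝ) ≤ Real.exp (C.uMax : ℝ) * (Real.exp (C.uMax : ℝ) - 1) := by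
      have hb : ((8 * C.T2 : ℚ) : ℝ) ≤ (((eU * (eU - 1)) : ℚ) : ℝ) := by exact_mod_cast hbig
      push_cast at hb
      refine hb.trans ?_
      nlinarith
    have h := pulled_le_of_le_u (C.T1 : ℝ) (C.T2 : ℝ) T u (C.uMax : ℝ) s hT1r hT hT' hgt.le hbig' hs1 hs2
    refine le_trans (h.trans ?_) hrhs
    have hmono : 4 * (C.uMax : ℝ) - (Real.exp (C.uMax : ℝ) - 1) ^ 2 / (4 * (C.T2 : ℝ)) ≤
        (((4 * C.uMax - (eU - 1) ^ 2 / (4 * C.T2)) : ℚ) : ℝ) := by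
      push_cast
      have hT2 : (0 : ℝ) < (C.T2 : ℝ) := hT1r.trans_le (by exact_mod_cast hT12)
      have hsq : (((eU : ℚ) : ℝ) - 1) ^ 2 ≤ (Real.exp (C.uMax : ℝ) - 1) ^ 2 := by
        apply pow_le_pow_left₀ (by linarith) (by linarith)
      have := div_le_div_of_nonneg_right hsq (by positivity : (0 : ℝ) ≤ 4 * (C.T2 : ℝ))
      linarith
    have h4 := exp_le_expHi (4 * C.uMax - (eU - 1) ^ 2 / (4 * C.T2)) C.prec
    have hhigh' : (((expHi (4 * C.uMax - (eU - 1) ^ 2 / (4 * C.T2)) C.prec / (6 * C.T1 ^ 2) : ℚ)) : ℝ) ≤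
        (C.c : ℝ) := by exact_mod_cast hhigh
    push_cast at hhigh'
    calc (6 * (C.T1 : ℝ) ^ 2)⁻¹ * Real.exp (4 * (C.uMax : ℝ) - (Real.exp (C.uMax : ℝ) - 1) ^ 2 / (4 * (C.T2 : ℝ)))
        ≤ (6 * (C.T1 : ℝ) ^ 2)⁻¹ * ((expHi (4 * C.uMax - (eU - 1) ^ 2 / (4 * C.T2)) C.prec : ℚ) : ℝ) := by
          refine mul_le_mul_of_nonneg_left ((Real.exp_le_exp.2 hmono).trans h4) (by positivity)
      _ = ((expHi (4 * C.uMax - (eU - 1) ^ 2 / (4 * C.T2)) C.prec : ℚ) : ℝ) / (6 * (C.T1 : ℝ) ^ 2) := by ring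
      _ ≤ (C.c : ℝ) := by simpa using hhigh'

/-- The structural facts of an accepted cell: positive `τ`'s, nonnegative weights and area atom, and the
mass bound. [folklore] -/
theorem checkCell_facts {M : ℚ} (h : checkCell C M = true) :
    atomsOK C C.atoms = true ∧ 0 ≤ C.c ∧ weightSum C.atoms + C.c ≤ M := by
  simp only [checkCell, Bool.and_eq_true, decide_eq_true_eq] at h
  obtain ⟨⟨⟨⟨⟨⟨⟨_, _⟩, hc⟩, _⟩, hat⟩, hm⟩, _⟩, _⟩ := h
  exact ⟨hat, hc, hm⟩

/-! ### From a cell to the registered shape -/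

/-- `atomsVal` as a `Fin`-indexed sum. [folklore] -/
theorem atomsVal_eq_sum (as : List Atom) (u s : ℝ) :
    atomsVal as u s = ∑ j : Fin as.length, (as.get j).val u s := by
  induction as with
  | nil => simp [atomsVal]
  | cons a as ih =>
    show a.val u s + atomsVal as u s = ∑ j : Fin (as.length + 1), ((a :: as).get j).val u s
    rw [Fin.sum_univ_succ, ih]
    rfl

/-- `weightSum` as a `Fin`-indexed sum (cast to `ℝ`). [folklore] -/
theorem weightSum_eq_sum (as : List Atom) :
    ((weightSum as : ℚ) : ℝ) = ∑ j : Fin as.length, ((as.get j).w : ℝ) := by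
  induction as with
  | nil => simp [weightSum]
  | cons a as ih =>
    show (((a.w + weightSum as : ℚ)) : ℝ) = ∑ j : Fin (as.length + 1), (((a :: as).get j).w : ℝ)
    rw [Rat.cast_add, Fin.sum_univ_succ, ih]
    rfl

/-- Every atom of a validated list is validated. [folklore] -/
theorem atomsOK_get {as : List Atom} (hall : atomsOK C as = true) (j : Fin as.length) :
    atomOK C (as.get j) = true := by
  induction as with
  | nil => exact j.elim0
  | cons a as ih =>
    simp only [atomsOK, Bool.and_eq_true] at hall
    refine Fin.cases ?_ (fun i => ?_) j
    · exact hall.1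
    · exact ih hall.2 i

/-- **An accepted cell yields the registered certificate statement** for every `T` of the cell
(with `M = 147/100`). [folklore] -/
theorem certificate_of_checkCell (h : checkCell C (147 / 100) = true) {T : ℝ}
    (hT : ((C.T1 : ℚ) : ℝ) ≤ T) (hT' : T ≤ ((C.T2 : ℚ) : ℝ)) :
    ∃ (n : ℕ) (σ τ w : Fin n → ℝ) (c : ℝ), (∀ j, 0 < τ j) ∧ (∀ j, 0 ≤ w j) ∧ 0 ≤ c ∧
      (∑ j, w j) + c ≤ 147 / 100 ∧
      ∀ u s : ℝ, -1 ≤ s → s ≤ 1 →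
        (8 * Real.pi ^ 2 / 3) * ((4 * Real.pi * T) ^ 2)⁻¹ * Real.exp (4 * u) *
            Real.exp (-(Real.exp (2 * u) - 2 * Real.exp u * s + 1) / (4 * T)) ≤
          (∑ j, w j * (zonal (τ j) s * Real.exp (-(u - σ j) ^ 2 / (4 * τ j)))) + c := by
  obtain ⟨hat, hc, hm⟩ := checkCell_facts C h
  refine ⟨C.atoms.length, fun j => ((C.atoms.get j).σ : ℝ), fun j => (C.atoms.get j).tau,
    fun j => ((C.atoms.get j).w : ℝ), (C.c : ℝ), fun j => tau_pos C (atomsOK_get C hat j),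
    fun j => ?_, by exact_mod_cast hc, ?_, ?_⟩
  · show (0 : ℝ) ≤ ((C.atoms.get j).w : ℝ)
    exact_mod_cast (atomOK_sound C (atomsOK_get C hat j)).2.2.1
  · have hm' : ((weightSum C.atoms + C.c : ℚ) : ℝ) ≤ ((147 / 100 : ℚ) : ℝ) := by exact_mod_cast hm
    push_cast at hm'
    rw [weightSum_eq_sum] at hm'
    exact hm'
  · intro u s hs1 hs2
    have hmain := checkCell_sound C h hT hT' u s hs1 hs2
    unfold pulledR Cell.rhs at hmain
    rw [atomsVal_eq_sum] at hmain
    exact hmain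

/-! ### Covers -/

/-- **Cover soundness**: an accepted cover of `[a, b]` yields the registered certificate statement for
every real `T ∈ [a, b]`. [folklore] -/
theorem certificates_of_checkCover :
    ∀ (cells : List Cell) (a b : ℚ), checkCover cells a b (147 / 100) = true →
      ∀ T : ℝ, ((a : ℚ) : ℝ) ≤ T → T ≤ ((b : ℚ) : ℝ) →
        ∃ (n : ℕ) (σ τ w : Fin n → ℝ) (c : ℝ), (∀ j, 0 < τ j) ∧ (∀ j, 0 ≤ w j) ∧ 0 ≤ c ∧
          (∑ j, w j) + c ≤ 147 / 100 ∧
          ∀ u s : ℝ, -1 ≤ s → s ≤ 1 →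
            (8 * Real.pi ^ 2 / 3) * ((4 * Real.pi * T) ^ 2)⁻¹ * Real.exp (4 * u) *
                Real.exp (-(Real.exp (2 * u) - 2 * Real.exp u * s + 1) / (4 * T)) ≤
              (∑ j, w j * (zonal (τ j) s * Real.exp (-(u - σ j) ^ 2 / (4 * τ j)))) + c := by
  intro cells
  induction cells with
  | nil => intro a b h; simp [checkCover] at h
  | cons C rest ih =>
    intro a b h T ha hb
    cases rest with
    | nil =>
      simp only [checkCover, Bool.and_eq_true, decide_eq_true_eq] at h
      obtain ⟨⟨h1, h2⟩, hC⟩ := h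
      exact certificate_of_checkCell C hC (le_trans (by exact_mod_cast h1) ha)
        (hb.trans (by exact_mod_cast h2))
    | cons C' rest' =>
      simp only [checkCover, Bool.and_eq_true, decide_eq_true_eq] at h
      obtain ⟨⟨⟨h1, h2⟩, hC⟩, hrest⟩ := h
      rcases le_or_gt T ((C.T2 : ℚ) : ℝ) with hle | hgt
      · exact certificate_of_checkCell C hC (le_trans (by exact_mod_cast h1) ha) hle
      · exact ih C'.T1 b hrest T (le_trans (by exact_mod_cast h2) hgt.le) hb


end Cert

/-- Registered helper `helper_certCheckCover` of crux stmt-SmoothPoincare4-7632: the soundness of the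
certificate checker, in the shape consumed by the decade stubs `stub_certMidA/B/C`. [folklore] -/
theorem helper_certCheckCover : ∀ (cells : List Cert.Cell) (a b : ℚ),
    Cert.checkCover cells a b (147 / 100) = true →
      ∀ T : ℝ, ((a : ℚ) : ℝ) ≤ T → T ≤ ((b : ℚ) : ℝ) →
        ∃ (n : ℕ) (σ τ w : Fin n → ℝ) (c : ℝ), (∀ j, 0 < τ j) ∧ (∀ j, 0 ≤ w j) ∧ 0 ≤ c ∧
          (∑ j, w j) + c ≤ 147 / 100 ∧
          ∀ u s : ℝ, -1 ≤ s → s ≤ 1 →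
            (8 * Real.pi ^ 2 / 3) * ((4 * Real.pi * T) ^ 2)⁻¹ * Real.exp (4 * u) *
                Real.exp (-(Real.exp (2 * u) - 2 * Real.exp u * s + 1) / (4 * T)) ≤
              (∑ j, w j * (zonal (τ j) s * Real.exp (-(u - σ j) ^ 2 / (4 * τ j)))) + c :=
  Cert.certificates_of_checkCover

end Summit.SmoothPoincare4.SmoothPoincare4.Theorems.CylinderEntropySliceIsolation

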